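import Literature.MathematicalPhysics.StatisticalMechanics.BarlowStacking
import Literature.MathematicalPhysics.StatisticalMechanics.HaggStacking
import Literature.MathematicalPhysics.StatisticalMechanics.HcpHomogeneous

/-!
# drefute evidence for line `c-layer-witness-strictness` (crux `SlackRigidity`, stmt-AtomisticToContinuum-11960):
a sorry-free proof of `stub_witness` (the c-layer witness selects hcp)

POSITIVE evidence (refuter seat `refuter-drefute-stmt-AtomisticToContinuum-11960-0`): the stub as
registered is TRUE; this file proves its statement verbatim (`stub_witness_proof`).  Not landed by the
refuter (positive results are a prover's landing) — attached to the crux item for the lead to inline.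

Proof: a cubic letter `s m = s (m+1) = σ` gives `haggLabel s (m+2) = haggLabel s m + 2σ`, and then
`barlowPos s m 0 0` and `barlowPos s (m+2) 2 (−2σ)` are at squared distance
`4a² + 4a²/3 + 4h² = 16a²/3 + 4h²` (`dist_barlowPos_sq`); so the hypothesis forces
`s (m+1) = −s m` for all `m`, i.e. `s = s 0 · alternatingHagg`; for `s 0 = 1` the stacking IS
`hcpStacking`, for `s 0 = −1` it is the half-turn image of `hcpStacking` (labels negate:
`haggLabel (−s) = −haggLabel s`, and `halfTurn (barlowPos alt k i j) = barlowPos (−alt) k (−i) (−j)`).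
-/

noncomputable section

namespace Summit.AtomisticToContinuum.Crystallization.Cruxes.SlackRigidity.DrefuteEvidence

open Literature.MathematicalPhysics.StatisticalMechanics

/-- Ambient space `ℝ³`. -/
local notation "E3" => EuclideanSpace ℝ (Fin 3)

section

variable (a h : ℝ)

/-- A cubic letter `s m = s (m+1) = 1` realises the c-layer witness distance `√(16a²/3 + 4h²)`. [folklore] -/
theorem dist_sq_witness_pos {s : ℤ → ℤ} (m : ℤ) (h0 : s m = 1) (h1 : s (m + 1) = 1) :
    dist (barlowPos a h s m 0 0) (barlowPos a h s (m + 2) 2 (-2)) ^ 2 = 16 * a ^ 2 / 3 + 4 * h ^ 2 := by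
  have hL : haggLabel s (m + 2) = haggLabel s m + 2 := by
    have e1 := haggLabel_succ s m
    have e2 := haggLabel_succ s (m + 1)
    rw [show m + 1 + 1 = m + 2 by ring] at e2
    rw [e2, e1, h0, h1]; ring
  have h3 : (√3 : ℝ) ^ 2 = 3 := Real.sq_sqrt (by norm_num)
  rw [dist_barlowPos_sq, hL]
  push_cast
  linear_combination (4 * a ^ 2 / 9) * h3

/-- A cubic letter `s m = s (m+1) = −1` realises the c-layer witness distance `√(16a²/3 + 4h²)`. [folklore] -/
theorem dist_sq_witness_neg {s : ℤ → ℤ} (m : ℤ) (h0 : s m = -1) (h1 : s (m + 1) = -1) :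
    dist (barlowPos a h s m 0 0) (barlowPos a h s (m + 2) 2 2) ^ 2 = 16 * a ^ 2 / 3 + 4 * h ^ 2 := by
  have hL : haggLabel s (m + 2) = haggLabel s m - 2 := by
    have e1 := haggLabel_succ s m
    have e2 := haggLabel_succ s (m + 1)
    rw [show m + 1 + 1 = m + 2 by ring] at e2
    rw [e2, e1, h0, h1]; ring
  have h3 : (√3 : ℝ) ^ 2 = 3 := Real.sq_sqrt (by norm_num)
  rw [dist_barlowPos_sq, hL]
  push_cast
  linear_combination (4 * a ^ 2 / 9) * h3

/-- Under the witness hypothesis a Hägg sequence has no cubic letter: `s (m+1) = −s m`. [folklore] -/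
theorem alt_of_noWitness {s : ℤ → ℤ} (hs : IsHaggSeq s)
    (hno : ∀ x ∈ barlowStacking a h s, ∀ y ∈ barlowStacking a h s,
      dist x y ^ 2 ≠ 16 * a ^ 2 / 3 + 4 * h ^ 2) (m : ℤ) : s (m + 1) = -s m := by
  rcases hs m with h0 | h0 <;> rcases hs (m + 1) with h1 | h1
  · exact absurd (dist_sq_witness_pos a h m h0 h1)
      (hno _ (barlowPos_mem m 0 0) _ (barlowPos_mem (m + 2) 2 (-2)))
  · rw [h0, h1]
  · rw [h0, h1]; norm_num
  · exact absurd (dist_sq_witness_neg a h m h0 h1)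
      (hno _ (barlowPos_mem m 0 0) _ (barlowPos_mem (m + 2) 2 2))

end

/-- `alternatingHagg (m+1) = −alternatingHagg m`. [folklore] -/
theorem alternatingHagg_succ (m : ℤ) : alternatingHagg (m + 1) = -alternatingHagg m := by
  unfold alternatingHagg
  by_cases hm : Even m
  · have h1 : ¬ Even (m + 1) := Int.not_even_iff_odd.2 hm.add_one
    simp [hm, h1]
  · have h1 : Even (m + 1) := (Int.not_even_iff_odd.1 hm).add_one
    simp [hm, h1]

/-- A sequence without cubic letters is `s 0 · alternatingHagg`. [folklore] -/
theorem eq_mul_alternating {s : ℤ → ℤ} (halt : ∀ m, s (m + 1) = -s m) (m : ℤ) :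
    s m = s 0 * alternatingHagg m := by
  induction m using Int.induction_on with
  | zero => simp [alternatingHagg]
  | succ n ih => rw [halt, ih, alternatingHagg_succ]; ring
  | pred n ih =>
    have e0 := halt (-(n : ℤ) - 1)
    rw [show -(n : ℤ) - 1 + 1 = -n by ring] at e0
    have e1 : s (-(n : ℤ) - 1) = -s (-n) := by linarith
    have e2 := alternatingHagg_succ (-(n : ℤ) - 1)
    rw [show -(n : ℤ) - 1 + 1 = -n by ring] at e2
    have e3 : alternatingHagg (-(n : ℤ) - 1) = -alternatingHagg (-n) := by linarith
    rw [e1, ih, e3]; ring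

/-- Window sums of the negated sequence. [folklore] -/
theorem haggWindow_neg (s : ℤ → ℤ) (m : ℤ) (k : ℕ) :
    haggWindow (fun i => -s i) m k = -haggWindow s m k := by
  simp [haggWindow, Finset.sum_neg_distrib]

/-- Labels of the negated sequence are negated. [folklore] -/
theorem haggLabel_neg (s : ℤ → ℤ) (k : ℤ) : haggLabel (fun i => -s i) k = -haggLabel s k := by
  unfold haggLabel
  split_ifs <;> simp [haggWindow_neg]

section

variable (a h : ℝ)

/-- The half-turn maps hcp to the stacking of `−alternatingHagg` (labels `0, −1, 0, −1, …`). [folklore] -/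
theorem halfTurn_barlowPos_alternating (k i j : ℤ) :
    halfTurn (barlowPos a h alternatingHagg k i j) =
      barlowPos a h (fun m => -alternatingHagg m) k (-i) (-j) := by
  ext l
  fin_cases l
  · simp [haggLabel_neg, -mul_eq_mul_left_iff]; ring
  · simp [haggLabel_neg, -mul_eq_mul_left_iff]; ring
  · simp [-mul_eq_mul_left_iff]

end

/-- **`stub_witness` of line `c-layer-witness-strictness`, verbatim, sorry-free.**  If a Barlow stacking
`barlowStacking a h s` (`s` Hägg) realises the squared distance `16a²/3 + 4h²` between no two of its
points, it is `hcpStacking a h` up to a linear isometry (identity or half-turn about `e₃`). [folklore] -/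
theorem stub_witness_proof :
    ∀ (a h : ℝ), 0 < a → 0 < h → ∀ s : ℤ → ℤ, IsHaggSeq s →
      (∀ x ∈ barlowStacking a h s, ∀ y ∈ barlowStacking a h s,
        dist x y ^ 2 ≠ 16 * a ^ 2 / 3 + 4 * h ^ 2) →
      ∃ B : E3 →ₗᵢ[ℝ] E3, barlowStacking a h s = B '' hcpStacking a h := by
  intro a h _ _ s hs hno
  have halt := alt_of_noWitness a h hs hno
  have hform := eq_mul_alternating halt
  rcases hs 0 with h0 | h0
  · have hs' : s = alternatingHagg := funext fun m => by rw [hform m, h0, one_mul]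
    refine ⟨LinearIsometry.id, ?_⟩
    rw [hs']
    simp [hcpStacking]
  · have hs' : s = fun m => -alternatingHagg m := funext fun m => by rw [hform m, h0]; ring
    refine ⟨halfTurn.toLinearIsometry, ?_⟩
    subst hs'
    ext x
    constructor
    · rintro ⟨k, i, j, rfl⟩
      refine ⟨barlowPos a h alternatingHagg k (-i) (-j), ⟨k, -i, -j, rfl⟩, ?_⟩
      simp only [LinearIsometryEquiv.coe_toLinearIsometry]
      rw [halfTurn_barlowPos_alternating]
      simp
    · rintro ⟨y, ⟨k, i, j, rfl⟩, rfl⟩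
      refine ⟨k, -i, -j, ?_⟩
      simp only [LinearIsometryEquiv.coe_toLinearIsometry]
      rw [halfTurn_barlowPos_alternating]

end Summit.AtomisticToContinuum.Crystallization.Cruxes.SlackRigidity.DrefuteEvidence

end
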